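import Summits.Ventures.HSemireg.WedgeHankelRecurrenceGaussSymmetrization

/-!
# Venture HSemireg — **THE RECURRENCE OF THE KERNEL POLYNOMIALS (Christoffel's linear factor; Galant ∕ Gautschi)**: for `q_0 = 1`, `q_1 = X − a_0`, `q_{n+2} = (X − a_{n+1}) q_{n+1} − b_{n+1} q_n`
# and a point `κ` with `q_m(κ) ≠ 0`, put `r_n = q_{n+1}(κ)∕q_n(κ)` and let `p_n` be the monic KERNEL polynomials `(X − κ) p_n = q_{n+1} − r_n q_n`; then `r_n r_{n+1} = (κ − a_{n+1}) r_n − b_{n+1}`,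
# and **`p_0 = 1`, `p_1 = X − ã_0`, `p_{n+2} = (X − ã_{n+1}) p_{n+1} − b̃_{n+1} p_n` with `ã_n = a_{n+1} + r_{n+1} − r_n`, `b̃_{n+1} r_n = b_{n+1} r_{n+1}`** (GALANT's algorithm for the
# recurrence coefficients of the Christoffel transform `(x − κ) dμ`); for `κ` left of the zeros all `r_n < 0`, so `b̃_{n+1} = b_{n+1} r_{n+1}∕r_n > 0`: the kernel polynomials form a POSITIVE recurrence

HONEST FRAMING. Part of the Lean index of the computation cell `pub-hsemireg` (seat p10 gen 46, Sunday typer «UNIFORM-IN-n»).  Real polynomials only; no variety, no cohomology theory, no sheaf, no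
Ext group and no semiregularity map is constructed here; nothing here says that HC / HC_CM / HC_AV holds; no Literature fact (unproved `Prop`) is declared or used.  Custodian versions as in
`WedgeHankelSiegelIdeal` (1/3).
SOURCES (cited).  E. B. Christoffel, *Über die Gaußische Quadratur und eine Verallgemeinerung derselben*, J. reine angew. Math. 55 (1858) 61–82; D. Galant, *An implementation of
Christoffel's theorem in the theory of orthogonal polynomials*, Math. Comp. 25 (1971) 111–113; W. Gautschi, *Orthogonal Polynomials: Computation and Approximation* (2004), §2.4.2 (modification by a
linear factor, eq. (2.4.10)–(2.4.13)); T. S. Chihara, *An Introduction to Orthogonal Polynomials* (1978), Ch. I §7 (kernel polynomials, Thm 7.1) and §9 (9.3)–(9.6); G. Szegő, *Orthogonal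
Polynomials*, Thm 2.5.
PROOF TYPED HERE.  `r_{n+1} q_{n+1}(κ) = q_{n+2}(κ) = (κ − a_{n+1}) q_{n+1}(κ) − b_{n+1} q_n(κ)` and `q_{n+1}(κ) = r_n q_n(κ)`, cancel `q_n(κ)`; the recurrence of the `p_n` is checked after
multiplication by `(X − κ) · r_n`: with `P_m = q_{m+1} − r_m q_m`, `r_n (P_{n+2} − (X − ã_{n+1}) P_{n+1} + b̃_{n+1} P_n)` is an explicit `ℝ[X]`-combination of the two scalar identities and of
`b̃_{n+1} r_n = b_{n+1} r_{n+1}` (`linear_combination` after expanding `q_{n+3}`, `q_{n+2}`); cancellation in the domain `ℝ[X]`.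
DEDUP DISCLOSURE (`rg -n -i 'kernel_polynomial_rec|galant|christoffel_linear_coeff|kernel_recurrence' Summits/Ventures/HSemireg`, 2026-09-03): N266 `christoffel_theorem_linear` gives the
ORTHOGONALITY of `q_{n+1} q_n(κ) − q_n q_{n+1}(κ)` for `(x − κ) dμ` and N2xx the reproducing ∕ CD kernels; the RECURRENCE COEFFICIENTS of the kernel polynomials are new (N374
`stieltjes_kernel_identities` is the case `κ = 0` in Stieltjes' coordinates).  The 5 names below: 0 hits tree-wide.

WHAT IS IN THE TREE.  N266 `christoffel_theorem_linear`; N372 `recurrence_forall_eval_alt_iff`; Mathlib `Polynomial.mul_divByMonic_eq_iff_isRoot`, `Polynomial.X_sub_C_ne_zero`.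
THIS FILE (namespace `Summit.Ventures.HSemireg.Wedge.HankelOuter` continued; CHAINED on N374 (import only); 0 definitions):
* §1140 `kernel_ratio_step` (`r_n r_{n+1} = (κ − a_{n+1}) r_n − b_{n+1}`), `kernel_polynomial_exists` (the `p_n` exist: `κ` is a root of `q_{n+1} − r_n q_n`), `kernel_recurrence_key` (the
  `ℝ[X]`-identity), **`kernel_polynomial_recurrence`** (GALANT: `p_0 = 1`, `p_1 = X − ã_0`, `p_{n+2} = (X − ã_{n+1}) p_{n+1} − b̃_{n+1} p_n`), **`kernel_recurrence_coupling_pos`** (`κ` left of the zeros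
  of `q_{N+1}` ⇒ `r_n < 0` and `b̃_{n+1} = b_{n+1} r_{n+1}∕r_n > 0`).
CAVEATS.  Finite ranges (`q_m(κ) ≠ 0` for `m ≤ N + 1`); the orthogonality of the `p_n` for `(x − κ) dμ` is N266 and is not re-proved here.  Nothing Ext-side.  New names only.
-/

open Module Polynomial
open scoped Matrix Polynomial

namespace Summit.Ventures.HSemireg.Wedge.HankelOuter

/-! ## §1140. The kernel-polynomial recurrence (Christoffel's linear factor) -/

/-- **The ratio recurrence: `r_n r_{n+1} = (κ − a_{n+1}) r_n − b_{n+1}`** when `r_m q_m(κ) = q_{m+1}(κ)` (`m = n, n+1`) and `q_n(κ) ≠ 0`. [Gautschi (2.4.12); this file, §1140] -/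
theorem kernel_ratio_step {q : ℕ → ℝ[X]} {a b r : ℕ → ℝ} {κ : ℝ}
    (hrec : ∀ n, q (n + 2) = (Polynomial.X - C (a (n + 1))) * q (n + 1) - C (b (n + 1)) * q n) (n : ℕ) (hqκ : (q n).eval κ ≠ 0)
    (hr0 : r n * (q n).eval κ = (q (n + 1)).eval κ) (hr1 : r (n + 1) * (q (n + 1)).eval κ = (q (n + 2)).eval κ) :
    r n * r (n + 1) = (κ - a (n + 1)) * r n - b (n + 1) := by
  rw [hrec n, eval_sub, eval_mul, eval_mul, eval_sub, eval_X, eval_C, eval_C, ← hr0] at hr1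
  apply mul_right_cancel₀ hqκ
  linear_combination hr1

/-- **The kernel polynomials exist**: `κ` is a root of `q_{n+1} − r_n q_n`, so `(X − κ) p_n = q_{n+1} − r_n q_n` is solvable (`p_n` = the quotient). [bookkeeping; this file, §1140] -/
theorem kernel_polynomial_exists {q : ℕ → ℝ[X]} {r : ℕ → ℝ} {κ : ℝ} {N : ℕ} (hr : ∀ n, n ≤ N → r n * (q n).eval κ = (q (n + 1)).eval κ) :
    ∃ p : ℕ → ℝ[X], ∀ n, n ≤ N → (Polynomial.X - C κ) * p n = q (n + 1) - C (r n) * q n := by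
  refine ⟨fun n => (q (n + 1) - C (r n) * q n) /ₘ (Polynomial.X - C κ), fun n hn => ?_⟩
  rw [mul_divByMonic_eq_iff_isRoot, IsRoot, eval_sub, eval_mul, eval_C, ← hr n hn, sub_self]

/-- **The `ℝ[X]`-identity behind Galant's step**: with `P_m = q_{m+1} − r_m q_m`, `ã_{n+1} = a_{n+2} + r_{n+2} − r_{n+1}` and `b̃_{n+1} r_n = b_{n+1} r_{n+1}`,
`r_n · (P_{n+2} − (X − ã_{n+1}) P_{n+1} + b̃_{n+1} P_n) = 0`. [this file, §1140] -/
theorem kernel_recurrence_key {q : ℕ → ℝ[X]} {a b r : ℕ → ℝ} {κ Bt : ℝ}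
    (hrec : ∀ n, q (n + 2) = (Polynomial.X - C (a (n + 1))) * q (n + 1) - C (b (n + 1)) * q n) (n : ℕ)
    (hs0 : r n * r (n + 1) = (κ - a (n + 1)) * r n - b (n + 1)) (hs1 : r (n + 1) * r (n + 2) = (κ - a (n + 2)) * r (n + 1) - b (n + 2)) (hB : Bt * r n = b (n + 1) * r (n + 1)) :
    C (r n) * ((q (n + 3) - C (r (n + 2)) * q (n + 2)) - ((Polynomial.X - C (a (n + 2) + r (n + 2) - r (n + 1))) * (q (n + 2) - C (r (n + 1)) * q (n + 1)) -
      C Bt * (q (n + 1) - C (r n) * q n))) = 0 := by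
  have hs0' : C (r n) * C (r (n + 1)) = (C κ - C (a (n + 1))) * C (r n) - C (b (n + 1)) := by rw [← map_mul, ← map_sub, ← map_mul, ← map_sub, hs0]
  have hs1' : C (r (n + 1)) * C (r (n + 2)) = (C κ - C (a (n + 2))) * C (r (n + 1)) - C (b (n + 2)) := by rw [← map_mul, ← map_sub, ← map_mul, ← map_sub, hs1]
  have hB' : C Bt * C (r n) = C (b (n + 1)) * C (r (n + 1)) := by rw [← map_mul, ← map_mul, hB]
  rw [show n + 3 = (n + 1) + 2 by ring, hrec (n + 1), hrec n, map_sub, map_add]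
  linear_combination (-(q (n + 1)) * C (r n)) * hs1' + (q (n + 1) * C (r (n + 1))) * hs0' + (q (n + 1) - C (r n) * q n) * hB'

/-- **GALANT'S RECURRENCE FOR THE KERNEL POLYNOMIALS**: if `q_m(κ) ≠ 0` (`m ≤ N + 1`), `r_m q_m(κ) = q_{m+1}(κ)` and `(X − κ) p_m = q_{m+1} − r_m q_m` (`m ≤ N + 1`), `ã_n = a_{n+1} + r_{n+1} − r_n`
and `b̃_{n+1} r_n = b_{n+1} r_{n+1}`, then `p_0 = 1`, `p_1 = X − ã_0` and `p_{n+2} = (X − ã_{n+1}) p_{n+1} − b̃_{n+1} p_n` for `n + 1 ≤ N` — the chapter's recurrence shape for the data `(ã, b̃)`.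
[Galant 1971; Gautschi (2.4.10)–(2.4.13); Chihara I Thm 7.1 ∕ (9.5); this file, §1140] -/
theorem kernel_polynomial_recurrence {q p : ℕ → ℝ[X]} {a b r A Bt : ℕ → ℝ} {κ : ℝ} {N : ℕ} (hq0 : q 0 = 1) (hq1 : q 1 = Polynomial.X - C (a 0))
    (hrec : ∀ n, q (n + 2) = (Polynomial.X - C (a (n + 1))) * q (n + 1) - C (b (n + 1)) * q n) (hqκ : ∀ m, m ≤ N + 1 → (q m).eval κ ≠ 0)
    (hr : ∀ m, m ≤ N + 1 → r m * (q m).eval κ = (q (m + 1)).eval κ) (hp : ∀ m, m ≤ N + 1 → (Polynomial.X - C κ) * p m = q (m + 1) - C (r m) * q m)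
    (hA : ∀ n, A n = a (n + 1) + r (n + 1) - r n) (hB : ∀ n, Bt (n + 1) * r n = b (n + 1) * r (n + 1)) :
    p 0 = 1 ∧ p 1 = Polynomial.X - C (A 0) ∧ ∀ n, n + 1 ≤ N → p (n + 2) = (Polynomial.X - C (A (n + 1))) * p (n + 1) - C (Bt (n + 1)) * p n := by
  have hXκ : (Polynomial.X - C κ : ℝ[X]) ≠ 0 := X_sub_C_ne_zero κ
  have hr0 : r 0 = κ - a 0 := by have := hr 0 (by omega); rwa [hq0, hq1, eval_one, mul_one, eval_sub, eval_X, eval_C] at this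
  have hstar : ∀ n, n ≤ N → r n * r (n + 1) = (κ - a (n + 1)) * r n - b (n + 1) := fun n hn =>
    kernel_ratio_step hrec n (hqκ n (by omega)) (hr n (by omega)) (hr (n + 1) (by omega))
  refine ⟨?_, ?_, fun n hn => ?_⟩
  · apply mul_left_cancel₀ hXκ
    rw [hp 0 (by omega), hq1, hq0, hr0, map_sub, mul_one, mul_one]
    ring
  · apply mul_left_cancel₀ hXκ
    have hs := hstar 0 (by omega)
    have hs' : C (r 0) * C (r 1) = (C κ - C (a 1)) * C (r 0) - C (b 1) := by rw [← map_mul, ← map_sub, ← map_mul, ← map_sub, hs]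
    have hr0' : C (r 0) = C κ - C (a 0) := by rw [← map_sub, hr0]
    rw [hp 1 (by omega), hrec 0, hq1, hq0, hA, map_sub, map_add, mul_one, zero_add]
    linear_combination (C (a 1) + C (r 1) - Polynomial.X) * hr0' + (-1 : ℝ[X]) * hs'
  · -- multiply by `(X − κ)` and by `C (r n)` (both non-zero) and use the key identity
    have hrn : r n ≠ 0 := fun h0 => by
      have := hr n (by omega); rw [h0, zero_mul] at this; exact hqκ (n + 1) (by omega) this.symm
    have hCr : (C (r n) : ℝ[X]) ≠ 0 := by rwa [Ne, C_eq_zero]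
    apply mul_left_cancel₀ hXκ
    apply mul_left_cancel₀ hCr
    have key := kernel_recurrence_key hrec n (hstar n (by omega)) (hstar (n + 1) hn) (hB n)
    have e2 := hp (n + 2) (by omega)
    have e1 := hp (n + 1) (by omega)
    have e0 := hp n (by omega)
    rw [hA (n + 1), show n + 1 + 1 = n + 2 from rfl]
    rw [show n + 2 + 1 = n + 3 from rfl] at e2
    linear_combination key + C (r n) * e2 - (C (r n) * (Polynomial.X - C (a (n + 2) + r (n + 2) - r (n + 1)))) * e1 + (C (r n) * C (Bt (n + 1))) * e0

/-- **POSITIVITY: for `κ` left of all zeros of `q_{N+1}` the ratios are negative and Galant's couplings are positive** — `r_n < 0` (`n ≤ N`) and `b̃_{n+1} = b_{n+1} r_{n+1}∕r_n > 0` (`n + 1 ≤ N`), so the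
kernel polynomials `p_0, …, p_N` satisfy a POSITIVE recurrence of the chapter's shape. [Chihara I Thm 7.2; Gautschi §2.4.2; this file, §1140] -/
theorem kernel_recurrence_coupling_pos {q : ℕ → ℝ[X]} {a b r : ℕ → ℝ} {κ : ℝ} {N : ℕ} (hq0 : q 0 = 1) (hq1 : q 1 = Polynomial.X - C (a 0))
    (hrec : ∀ n, q (n + 2) = (Polynomial.X - C (a (n + 1))) * q (n + 1) - C (b (n + 1)) * q n) (hb : ∀ j, 0 < b j)
    (hκ : ∀ s, (q (N + 1)).eval s = 0 → κ < s) (hr : ∀ m, m ≤ N + 1 → r m * (q m).eval κ = (q (m + 1)).eval κ) :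
    (∀ m, m ≤ N + 1 → (q m).eval κ ≠ 0) ∧ (∀ n, n ≤ N → r n < 0) ∧ ∀ n, n + 1 ≤ N → 0 < b (n + 1) * r (n + 1) / r n := by
  have halt := (recurrence_forall_eval_alt_iff hq0 hq1 hrec hb N κ).2 hκ
  have hne : ∀ m, m ≤ N + 1 → (q m).eval κ ≠ 0 := fun m hm h0 => by
    have := halt m hm; rw [h0, mul_zero] at this; exact lt_irrefl _ this
  have hneg : ∀ n, n ≤ N → r n < 0 := fun n hn => by
    have h0 := halt n (by omega)
    have h1 := halt (n + 1) (by omega)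
    rw [← hr n (by omega), pow_succ] at h1
    -- `h1 : 0 < (−1)^n · (−1) · (r_n q_n(κ))`, `h0 : 0 < (−1)^n q_n(κ)`
    have : 0 < -r n * ((-1 : ℝ) ^ n * (q n).eval κ) := by linarith
    nlinarith
  exact ⟨hne, hneg, fun n hn => div_pos_of_neg_of_neg (mul_neg_of_pos_of_neg (hb _) (hneg (n + 1) hn)) (hneg n (by omega))⟩

end Summit.Ventures.HSemireg.Wedge.HankelOuter
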